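import Summits.Parity.GeneralizedHardyLittlewood.Theorems.LeeYangFibresRelativeDimOneSplitClassVariance
import HarnessLib

/-!
# Type-class moments: windows, the prime inputs and the thresholds (crux stmt-Parity-14113
`LeeYangFibres.RelativeDimOne`, line gallagher-backwards-split, RESHAPED type-conditioned split; aux for stub
`stub_typeClassMoments`, part C1)

The class functions of the type-class moments are window differences
`D(r) = ψ(hi; q, r) − ψ(lo; q, r)` (`lo ≤ hi`). This file supplies, in the shape consumed by the
expansion bound (part B):
* `window_pnt`: `|Σ_{r unit} D(r) − (hi − lo)| ≤ |ψ(hi) − hi| + |ψ(lo) − lo| + 4 log³ hi` (the ONE-deviation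
  input is the GLOBAL prime number theorem; the non-unit `Λ`-mass is `≤ 4 log³`);
* `window_variance`: `Σ_{r unit} (D(r) − (hi−lo)/φ)² ≤ 2 V(hi) + 2 V(lo)` (class variances at two heights);
* `two_sided_pnt`: `|ψ(N) − N| ≤ ε N` eventually (tree PNT `vonMangoldt_summatory_sub_isLittleO`);
* `self_div_totient_le` (registered hook): `q/φ(q) ≤ log₂ q + 1`, from `∏_{p∣q}(1 − 1/p) ≥ 1/(ω(q)+1)`;
* the eventual inequalities fixing the threshold `N₀` (`eventually_logpow_junk_le`, `eventually_rpow_le_mul_rpow`).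
-/

noncomputable section

open scoped BigOperators Classical Topology ArithmeticFunction.vonMangoldt
open Finset Filter
open Summit.Parity.GeneralizedHardyLittlewood.Cruxes.RelativeDimOne.GallagherBackwards (classPsi classPsi_nonneg)
open Summit.Parity.GeneralizedHardyLittlewood.Cruxes.RelativeDimOne.GallagherBackwardsSplit

namespace Summit.Parity.GeneralizedHardyLittlewood.Cruxes.RelativeDimOne.TypeSplit

namespace TCM

/-! ### Windows of `ψ(x; q, r)` -/

/-- `ψ(x; q, r)` is monotone in `x`. -/
theorem classPsi_mono {x y : ℕ} (h : x ≤ y) (q r : ℕ) : classPsi x q r ≤ classPsi y q r := by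
  unfold classPsi
  apply Finset.sum_le_sum_of_subset_of_nonneg
  · exact Finset.filter_subset_filter _ (Finset.Icc_subset_Icc le_rfl h)
  · intro n _ _
    exact ArithmeticFunction.vonMangoldt_nonneg

/-- The non-coprime `Λ`-mass `Bad(x) = Σ_{n ≤ x, gcd(n,q) ≠ 1} Λ(n)` is monotone in `x`. -/
theorem bad_mono {x y : ℕ} (h : x ≤ y) (q : ℕ) :
    ∑ n ∈ (Icc 1 x).filter (fun n => ¬ n.Coprime q), Λ n ≤
      ∑ n ∈ (Icc 1 y).filter (fun n => ¬ n.Coprime q), Λ n := by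
  apply Finset.sum_le_sum_of_subset_of_nonneg
  · exact Finset.filter_subset_filter _ (Finset.Icc_subset_Icc le_rfl h)
  · intro n _ _
    exact ArithmeticFunction.vonMangoldt_nonneg

/-- `Σ_{r < q, gcd(r,q)=1} ψ(x; q, r) = ψ(x) − Bad(x)`. -/
theorem sum_classPsi_filter_coprime (x q : ℕ) (hq : 0 < q) :
    ∑ r ∈ (range q).filter (fun r => r.Coprime q), classPsi x q r =
      ∑ n ∈ Icc 1 x, Λ n - ∑ n ∈ (Icc 1 x).filter (fun n => ¬ n.Coprime q), Λ n := by
  rw [Finset.sum_filter, ClassVariance.sum_classPsi_coprime x q hq, eq_sub_iff_add_eq]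
  exact Finset.sum_filter_add_sum_filter_not _ _ _

/-- ONE-DEVIATION INPUT OF A WINDOW: `|Σ_{r unit} (ψ(hi;q,r) − ψ(lo;q,r)) − (hi − lo)| ≤
|ψ(hi) − hi| + |ψ(lo) − lo| + 4 log³ hi` for `1 ≤ q ≤ hi`, `lo ≤ hi`. -/
theorem window_pnt (q lo hi : ℕ) (hq : 0 < q) (hqhi : q ≤ hi) (hlohi : lo ≤ hi) :
    |∑ r ∈ (range q).filter (fun r => r.Coprime q), (classPsi hi q r - classPsi lo q r) -
        ((hi : ℝ) - lo)| ≤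
      |∑ n ∈ Icc 1 hi, Λ n - hi| + |∑ n ∈ Icc 1 lo, Λ n - lo| + 4 * Real.log hi ^ 3 := by
  rw [Finset.sum_sub_distrib, sum_classPsi_filter_coprime hi q hq, sum_classPsi_filter_coprime lo q hq]
  set Bhi := ∑ n ∈ (Icc 1 hi).filter (fun n => ¬ n.Coprime q), (Λ n : ℝ) with hBhi
  set Blo := ∑ n ∈ (Icc 1 lo).filter (fun n => ¬ n.Coprime q), (Λ n : ℝ) with hBlo
  have h0 : 0 ≤ Blo := Finset.sum_nonneg fun n _ => ArithmeticFunction.vonMangoldt_nonneg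
  have h1 : Blo ≤ Bhi := bad_mono hlohi q
  have h2 : Bhi ≤ 4 * Real.log hi ^ 3 := ClassVariance.sum_vonMangoldt_not_coprime_le hq hqhi
  have h3 : |Bhi - Blo| ≤ 4 * Real.log hi ^ 3 := by
    rw [abs_of_nonneg (by linarith)]
    linarith
  calc |∑ n ∈ Icc 1 hi, Λ n - Bhi - (∑ n ∈ Icc 1 lo, Λ n - Blo) - ((hi : ℝ) - lo)|
      = |(∑ n ∈ Icc 1 hi, Λ n - hi) - (∑ n ∈ Icc 1 lo, Λ n - lo) - (Bhi - Blo)| := by ring_nf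
    _ ≤ |(∑ n ∈ Icc 1 hi, Λ n - hi) - (∑ n ∈ Icc 1 lo, Λ n - lo)| + |Bhi - Blo| := abs_sub _ _
    _ ≤ |∑ n ∈ Icc 1 hi, Λ n - hi| + |∑ n ∈ Icc 1 lo, Λ n - lo| + 4 * Real.log hi ^ 3 :=
        add_le_add (abs_sub _ _) h3

/-- TWO-DEVIATION INPUT OF A WINDOW: the unit sum of squares of `D(r) − (hi − lo)/φ` is at most twice
the class variances at the two heights. -/
theorem window_variance (q lo hi : ℕ) (φ Vhi Vlo : ℝ)
    (hVhi : ∑ r ∈ range q, (classPsi hi q r - if r.Coprime q then (hi : ℝ) / φ else 0) ^ 2 ≤ Vhi)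
    (hVlo : ∑ r ∈ range q, (classPsi lo q r - if r.Coprime q then (lo : ℝ) / φ else 0) ^ 2 ≤ Vlo) :
    ∑ r ∈ (range q).filter (fun r => r.Coprime q),
        (classPsi hi q r - classPsi lo q r - ((hi : ℝ) - lo) / φ) ^ 2 ≤ 2 * Vhi + 2 * Vlo := by
  rw [Finset.sum_filter]
  have hpt : ∀ r ∈ range q,
      (if r.Coprime q then (classPsi hi q r - classPsi lo q r - ((hi : ℝ) - lo) / φ) ^ 2 else 0) ≤
        2 * (classPsi hi q r - if r.Coprime q then (hi : ℝ) / φ else 0) ^ 2 +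
        2 * (classPsi lo q r - if r.Coprime q then (lo : ℝ) / φ else 0) ^ 2 := by
    intro r _
    split_ifs with h
    · have e : classPsi hi q r - classPsi lo q r - ((hi : ℝ) - lo) / φ =
          (classPsi hi q r - hi / φ) - (classPsi lo q r - lo / φ) := by ring
      rw [e]
      nlinarith [sq_nonneg ((classPsi hi q r - hi / φ) + (classPsi lo q r - lo / φ))]
    · positivity
  calc _ ≤ ∑ r ∈ range q, (2 * (classPsi hi q r - if r.Coprime q then (hi : ℝ) / φ else 0) ^ 2 +
        2 * (classPsi lo q r - if r.Coprime q then (lo : ℝ) / φ else 0) ^ 2) := Finset.sum_le_sum hpt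
    _ = 2 * ∑ r ∈ range q, (classPsi hi q r - if r.Coprime q then (hi : ℝ) / φ else 0) ^ 2 +
        2 * ∑ r ∈ range q, (classPsi lo q r - if r.Coprime q then (lo : ℝ) / φ else 0) ^ 2 := by
        rw [Finset.sum_add_distrib, Finset.mul_sum, Finset.mul_sum]
    _ ≤ 2 * Vhi + 2 * Vlo := by linarith

/-- Two-sided prime number theorem along the integers: `|ψ(N) − N| ≤ ε N` for `N ≥ N₀(ε)`. -/
theorem two_sided_pnt {ε : ℝ} (hε : 0 < ε) :
    ∃ N₀ : ℕ, ∀ N : ℕ, N₀ ≤ N → |∑ n ∈ Icc 1 N, Λ n - N| ≤ ε * N := by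
  have h := Literature.NumberTheory.LFunctions.vonMangoldt_summatory_sub_isLittleO.def hε
  rw [eventually_atTop] at h
  obtain ⟨N₀, hN₀⟩ := h
  refine ⟨N₀, fun N hN => ?_⟩
  have h1 := hN₀ N hN
  rwa [Real.norm_eq_abs, Real.norm_of_nonneg (Nat.cast_nonneg N)] at h1

/-! ### `q/φ(q) ≤ ω(q) + 1 ≤ log₂ q + 1` -/

/-- For a finite set `S` of integers `≥ 2`: `∏_{p ∈ S} (1 − 1/p) ≥ 1/(#S + 1)` (the `k`-th smallest element
is `≥ k + 1`). -/
theorem prod_one_sub_inv_ge (S : Finset ℕ) (hS : ∀ p ∈ S, 2 ≤ p) :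
    1 / ((S.card : ℝ) + 1) ≤ ∏ p ∈ S, (1 - (p : ℝ)⁻¹) := by
  induction S using Finset.induction_on_max with
  | empty => simp
  | insert a s ha ih =>
    have hs : ∀ p ∈ s, 2 ≤ p := fun p hp => hS p (Finset.mem_insert_of_mem hp)
    have ha2 : 2 ≤ a := hS a (Finset.mem_insert_self a s)
    have has : a ∉ s := fun h => lt_irrefl a (ha a h)
    rw [Finset.prod_insert has, Finset.card_insert_of_notMem has]
    have hcard : s.card + 2 ≤ a := by
      have hsub : s ⊆ Finset.Ico 2 a := fun p hp => Finset.mem_Ico.2 ⟨hs p hp, ha p hp⟩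
      have := Finset.card_le_card hsub
      rw [Nat.card_Ico] at this
      omega
    have hcardR : (s.card : ℝ) + 2 ≤ a := by exact_mod_cast hcard
    have ha0 : (0 : ℝ) < a := by linarith [hcardR, (Nat.cast_nonneg s.card : (0 : ℝ) ≤ s.card)]
    have hk0 : (0 : ℝ) ≤ s.card := Nat.cast_nonneg _
    have key : 1 / (((s.card + 1 : ℕ) : ℝ) + 1) ≤ (1 - (a : ℝ)⁻¹) * (1 / ((s.card : ℝ) + 1)) := by
      push_cast
      rw [inv_eq_one_div, show (1 - 1 / (a : ℝ)) * (1 / ((s.card : ℝ) + 1)) =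
        (a - 1) / (a * ((s.card : ℝ) + 1)) by field_simp,
        div_le_div_iff₀ (by positivity) (by positivity)]
      nlinarith
    have h1a : 0 ≤ 1 - (a : ℝ)⁻¹ := by
      rw [sub_nonneg]
      exact inv_le_one_of_one_le₀ (by linarith)
    exact key.trans (mul_le_mul_of_nonneg_left (ih hs) h1a)

/-- `q/φ(q) ≤ ω(q) + 1`. -/
theorem self_div_totient_le_card (q : ℕ) (hq : 0 < q) :
    (q : ℝ) / Nat.totient q ≤ (q.primeFactors.card : ℝ) + 1 := by
  have h := Nat.totient_eq_mul_prod_factors q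
  have h' : (Nat.totient q : ℝ) = q * ∏ p ∈ q.primeFactors, (1 - (p : ℝ)⁻¹) := by
    have := congrArg (Rat.cast : ℚ → ℝ) h
    push_cast at this
    exact this
  have hP : 1 / ((q.primeFactors.card : ℝ) + 1) ≤ ∏ p ∈ q.primeFactors, (1 - (p : ℝ)⁻¹) :=
    prod_one_sub_inv_ge _ fun p hp => (Nat.prime_of_mem_primeFactors hp).two_le
  have hφ : (0 : ℝ) < Nat.totient q := by exact_mod_cast Nat.totient_pos.2 hq
  have hq0 : (0 : ℝ) < q := by exact_mod_cast hq
  have hk : (0 : ℝ) < (q.primeFactors.card : ℝ) + 1 := by positivity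
  rw [div_le_iff₀ hφ, h']
  calc (q : ℝ) = ((q.primeFactors.card : ℝ) + 1) * (q * (1 / ((q.primeFactors.card : ℝ) + 1))) := by
        field_simp
    _ ≤ ((q.primeFactors.card : ℝ) + 1) * (q * ∏ p ∈ q.primeFactors, (1 - (p : ℝ)⁻¹)) :=
        mul_le_mul_of_nonneg_left (mul_le_mul_of_nonneg_left hP hq0.le) hk.le

/-- HOOK (registered): `q/φ(q) ≤ log₂ q + 1` for `q ≥ 1`. -/
theorem self_div_totient_le : ∀ q : ℕ, 0 < q → (q : ℝ) / Nat.totient q ≤ (Nat.log 2 q : ℝ) + 1 := by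
  intro q hq
  have h1 := self_div_totient_le_card q hq
  have h2 : (q.primeFactors.card : ℝ) ≤ Nat.log 2 q := by
    exact_mod_cast BrunTitchmarshAP.card_primeFactors_le_log hq
  linarith

/-! ### Thresholds -/

/-- `log₂ x + 1 ≤ 3 log x` and `log (L x) ≤ 2 log x` for real `x ≥ max(3, L)`, `L ≥ 1`. -/
theorem logb_and_log_mul_le {L x : ℝ} (hL : 1 ≤ L) (hx3 : 3 ≤ x) (hxL : L ≤ x) :
    Real.logb 2 x + 1 ≤ 3 * Real.log x ∧ Real.log (L * x) ≤ 2 * Real.log x := by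
  have hx0 : 0 < x := by linarith
  have hlog1 : 1 ≤ Real.log x := by
    rw [Real.le_log_iff_exp_le hx0]
    exact (Real.exp_one_lt_d9.le.trans (by norm_num)).trans hx3
  have hlog2 : (0.6931471803 : ℝ) < Real.log 2 := Real.log_two_gt_d9
  constructor
  · rw [Real.logb, div_add_one (by linarith), div_le_iff₀ (by linarith)]
    nlinarith
  · rw [Real.log_mul (by linarith) hx0.ne']
    have := Real.log_le_log (by linarith) hxL
    linarith

/-- THE JUNK THRESHOLD: for `θ < 1`, `A ≥ 0`, `c > 0`, `L ≥ 1` and `k : ℕ`, eventually in real `x`,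
`A (log₂ x + 1)^k x^θ · 4 log³(L x) ≤ c x`. -/
theorem eventually_logpow_junk_le {θ : ℝ} (hθ : θ < 1) {A c L : ℝ} (hA : 0 ≤ A) (hc : 0 < c)
    (hL : 1 ≤ L) (k : ℕ) :
    ∀ᶠ x : ℝ in atTop, A * (Real.logb 2 x + 1) ^ k * x ^ θ * (4 * Real.log (L * x) ^ 3) ≤ c * x := by
  set c' : ℝ := c / (32 * 3 ^ k * A + 1) with hc'
  have hden : (0 : ℝ) < 32 * 3 ^ k * A + 1 := by positivity
  have hc'0 : 0 < c' := div_pos hc hden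
  have e := (isLittleO_log_rpow_rpow_atTop (((k + 3 : ℕ)) : ℝ) (by linarith : (0 : ℝ) < 1 - θ)).def hc'0
  filter_upwards [e, eventually_ge_atTop (3 : ℝ), eventually_ge_atTop L] with x hx hx3 hxL
  have hx0 : 0 < x := by linarith
  obtain ⟨hlb, hlL⟩ := logb_and_log_mul_le hL hx3 hxL
  have hl0 : 0 ≤ Real.log x := Real.log_nonneg (by linarith)
  rw [Real.rpow_natCast, Real.norm_of_nonneg (pow_nonneg hl0 _),
    Real.norm_of_nonneg (Real.rpow_nonneg hx0.le _)] at hx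
  have hlb0 : 0 ≤ Real.logb 2 x + 1 := by
    have : 0 ≤ Real.logb 2 x := Real.logb_nonneg one_lt_two (by linarith)
    linarith
  have hlL0 : 0 ≤ Real.log (L * x) := Real.log_nonneg (by nlinarith)
  have h1 : (Real.logb 2 x + 1) ^ k ≤ 3 ^ k * Real.log x ^ k := by
    rw [← mul_pow]; exact pow_le_pow_left₀ hlb0 hlb k
  have h2 : Real.log (L * x) ^ 3 ≤ 8 * Real.log x ^ 3 := by
    calc Real.log (L * x) ^ 3 ≤ (2 * Real.log x) ^ 3 := pow_le_pow_left₀ hlL0 hlL 3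
      _ = 8 * Real.log x ^ 3 := by ring
  have hxθ : 0 ≤ x ^ θ := Real.rpow_nonneg hx0.le _
  have hsplit : x ^ (1 - θ) * x ^ θ = x := by
    rw [← Real.rpow_add hx0]; norm_num
  calc A * (Real.logb 2 x + 1) ^ k * x ^ θ * (4 * Real.log (L * x) ^ 3)
      ≤ A * (3 ^ k * Real.log x ^ k) * x ^ θ * (4 * (8 * Real.log x ^ 3)) := by
        gcongr
    _ = 32 * 3 ^ k * A * (Real.log x ^ (k + 3)) * x ^ θ := by ring
    _ ≤ 32 * 3 ^ k * A * (c' * x ^ (1 - θ)) * x ^ θ := by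
        gcongr
    _ = (32 * 3 ^ k * A) * c' * (x ^ (1 - θ) * x ^ θ) := by ring
    _ = (32 * 3 ^ k * A) * c' * x := by rw [hsplit]
    _ ≤ c * x := by
        apply mul_le_mul_of_nonneg_right _ hx0.le
        rw [hc', mul_div_assoc', div_le_iff₀ hden]
        nlinarith

/-- LEVEL THRESHOLD: for `θ' < θ` and `d > 0`, eventually `x^{θ'} ≤ d x^{θ}`. -/
theorem eventually_rpow_le_mul_rpow {θ θ' d : ℝ} (h : θ' < θ) (hd : 0 < d) :
    ∀ᶠ x : ℝ in atTop, x ^ θ' ≤ d * x ^ θ := by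
  have ht := tendsto_rpow_neg_atTop (by linarith : 0 < θ - θ')
  filter_upwards [ht.eventually (ge_mem_nhds hd), eventually_gt_atTop 0] with x hx hx0
  calc x ^ θ' = x ^ (-(θ - θ')) * x ^ θ := by
        rw [← Real.rpow_add hx0]; ring_nf
    _ ≤ d * x ^ θ := mul_le_mul_of_nonneg_right hx (Real.rpow_nonneg hx0.le _)

end TCM

end Summit.Parity.GeneralizedHardyLittlewood.Cruxes.RelativeDimOne.TypeSplit

end
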